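import Summits.BirchSwinnertonDyer.BirchSwinnertonDyer.Theorems.ManinLocalTwoThreeNewformsFiftySix
import Summits.BirchSwinnertonDyer.BirchSwinnertonDyer.Theorems.EdixhovenFibreFiveSevenTwistDegreeStepFiveSevenLTwistCore
import Literature.NumberTheory.EllipticCurves.ModularCurveEtaProductsProofs
import Literature.NumberTheory.EllipticCurves.ModularityVersionApProofs
import Literature.NumberTheory.EllipticCurves.CuspFormLFunctionLevelConductorProofs
import Literature.NumberTheory.EllipticCurves.CongruenceNumber
import Summits.BirchSwinnertonDyer.BirchSwinnertonDyer.Theorems.ManinLocalTwoThreeCurveExclusionFortyFour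
import HarnessLib

/-!
# Level 56 (C2, genus 5): the newform of every `X₀(56)`-datum is `P − Q` (`56a`) or `P + Q` (`56b`) — PINNED BY THE CURVE'S OWN
# RECURSION, fact-free (planner-an g51's turnkey T-an-g51-56, landed)

Cell bsd-f2-manin, route `ManinLocalTwoThree`, crux C2 `ManinOddAtFour` (stmt-22967: `4 ∣ 56`), prover seat p2 gen 28.  This is
planner-an g51's node `HOME/an/g51/Sketch-an-g51-L56.lean` (MEMO-an §96: «pinning by the curve's own recursion») with its twenty-one
`q`-coefficient hypotheses DISCHARGED by `NewformsFiftySix` (`cuspCoeff_P56`, `cuspCoeff_Q56`, `cuspCoeff_phi14`).  Nothing here proves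
C2, Manin's conjecture or BSD; the items stay OPEN as filed (⟸ CDT).

THE RESULT.  `S₂(Γ₀(56))` (genus 5) has the explicit basis `{ι₁φ₁₄, ι₂φ₁₄, ι₄φ₁₄, P, Q}` with `φ₁₄ = η₁η₂η₇η₁₄` (tree `cuspFormEta14`),
`ι_d = degeneracyMap0 14 56 d 2`, and the two `η`-quotients of level 56 `P = η₄³η₁₄³/(η₂η₂₈)`, `Q = η₂³η₂₈³/(η₄η₁₄)`
(`NewformsFiftySix.exists_cuspForm_P56/Q56`).  The two newforms of level 56 are `56a = P − Q` and `56b = P + Q`.  For every `X₀(56)`-datum `D`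
of an elliptic `W/ℚ`:  **`D.f = P − Q ∨ D.f = P + Q`** (`f_eq_fiftySix`) — with NO newness of any explicit form ever proved, NO trace,
NO Hecke eigenvalue computation on the space, NO Sturm, NO Hasse bound.

THE MECHANISM (MEMO-an §96.1): on the space `a₉ = −a₁ − a₃ − a₅`, `a₁₅ = −2a₁ − a₃ + a₅`; on the curve `a₂ = a₄ = 0`, `a₉ = a₃² − 3`,
`a₁₅ = a₃a₅` (conductor bits from the level, both tree theorems PROVED); so `(a₃, a₅) ∈ {(0, 2), (2, −4), (−2, 0)}`, the third vector is OLD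
and is killed by `old ⊓ new = ⊥` since `D.f` is new with `a₁ = 1`.
[cite: DiamondShurman2005, §8.8 (8.44), §5.7 p. 211, Thm. 3.5.1] [cite: AtkinLehner1970, Thm. 3, Thm. 5]
[cite: CremonaAlgorithms1997, Table 3 (N = 56)]
-/

set_option autoImplicit false
-- lint-debt: the directory name repeats the summit name (sibling precedent `ManinLocalTwoThreeNewformPinningFortyEight.lean`)
set_option linter.dupNamespace false

noncomputable section

open Complex Filter Topology Set Function
open UpperHalfPlane hiding I
open scoped Real Topology MatrixGroups ModularForm
open ModularForm CongruenceSubgroup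
open Literature.NumberTheory.ModularForms
open Literature.NumberTheory.EllipticCurves Literature.NumberTheory.EllipticCurves.ModularForms

namespace Summit.BirchSwinnertonDyer.BirchSwinnertonDyer.Theorems.ManinLocalTwoThree.NewformPinningFiftySix

open NewformsFiftySix

/-! ## §1 Generic: a newform is never an oldform; coefficients of combinations and of `ι_d g`; the curve's bits -/

section Generic

variable {N : ℕ} [NeZero N] {k : ℤ}

/-- `old ⊓ new = 0`, elementwise (tree `disjoint_oldSubspace0_newSubspace0_holds`). [cite: AtkinLehner1970, Thm. 5] -/
theorem eq_zero_of_mem_old_of_mem_new {f : CuspForm (Gamma0 N) k}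
    (hold : f ∈ oldSubspace0 N k) (hnew : f ∈ newSubspace0 N k) : f = 0 :=
  (Submodule.disjoint_def.mp (disjoint_oldSubspace0_newSubspace0_holds (N := N) (k := k))) f hold hnew

omit [NeZero N] in
/-- `aₙ(0) = 0`. [folklore] -/
theorem cuspCoeff_zero_form (n : ℕ) : cuspCoeff (0 : CuspForm (Gamma0 N) k) n = 0 := by
  have h := cuspCoeff_smul (N := N) (0 : ℂ) (0 : CuspForm (Gamma0 N) k) n
  rwa [zero_smul, zero_mul] at h

/-- **A newform is not an oldform** (`a₁ = 1 ≠ 0` and `old ⊓ new = 0`). [cite: AtkinLehner1970, Thm. 5] -/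
theorem not_mem_old_of_isNewform0 {f : CuspForm (Gamma0 N) k} (hf : IsNewform0 f) :
    f ∉ oldSubspace0 N k := fun hold ↦ by
  have h1 : cuspCoeff f 1 = 1 := hf.2.2
  rw [eq_zero_of_mem_old_of_mem_new hold hf.1, cuspCoeff_zero_form] at h1
  exact zero_ne_one h1

omit [NeZero N] in
/-- `aₙ` of a five-term combination. [folklore] -/
theorem cuspCoeff_comb₅ (x₁ x₂ x₃ x₄ x₅ : ℂ) (g₁ g₂ g₃ g₄ g₅ : CuspForm (Gamma0 N) k) (n : ℕ) :
    cuspCoeff (x₁ • g₁ + x₂ • g₂ + x₃ • g₃ + x₄ • g₄ + x₅ • g₅) n =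
      x₁ * cuspCoeff g₁ n + x₂ * cuspCoeff g₂ n + x₃ * cuspCoeff g₃ n + x₄ * cuspCoeff g₄ n + x₅ * cuspCoeff g₅ n := by
  simp only [cuspCoeff_add_form (one_mem_strictPeriods_coe_gamma0 N), cuspCoeff_smul]

/-- `aₙ(ι_d g) = d · a_{n/d}(g)` if `d ∣ n`, else `0` (weight 2; tree `LTwist.cuspCoeff_degeneracyMap0`).
[cite: DiamondShurman2005, §5.7 p. 211] -/
theorem cuspCoeff_iota {M L d : ℕ} [NeZero M] [NeZero L] [NeZero d] (h : M * d ∣ L)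
    (g : CuspForm (Gamma0 M) 2) (n : ℕ) :
    cuspCoeff (degeneracyMap0 M L d 2 g) n = (d : ℂ) * (if d ∣ n then cuspCoeff g (n / d) else 0) := by
  rw [Theorems.LTwist.cuspCoeff_degeneracyMap0 h g n, show ((2 : ℤ) - 1) = 1 by norm_num, zpow_one]

/-- `a_{dm}(ι_d g) = d · a_m(g)`. [cite: DiamondShurman2005, §5.7 p. 211] -/
theorem cuspCoeff_iota_mul {M L d : ℕ} [NeZero M] [NeZero L] [NeZero d] (h : M * d ∣ L)
    (g : CuspForm (Gamma0 M) 2) (m : ℕ) :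
    cuspCoeff (degeneracyMap0 M L d 2 g) (d * m) = (d : ℂ) * cuspCoeff g m := by
  rw [cuspCoeff_iota h, if_pos (dvd_mul_right d m), Nat.mul_div_cancel_left m (NeZero.pos d)]

/-- `aₙ(ι_d g) = 0` if `d ∤ n`. [cite: DiamondShurman2005, §5.7 p. 211] -/
theorem cuspCoeff_iota_of_not_dvd {M L d : ℕ} [NeZero M] [NeZero L] [NeZero d] (h : M * d ∣ L)
    (g : CuspForm (Gamma0 M) 2) {n : ℕ} (hn : ¬ d ∣ n) :
    cuspCoeff (degeneracyMap0 M L d 2 g) n = 0 := by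
  rw [cuspCoeff_iota h, if_neg hn, mul_zero]

/-- `aₙ(ι₁ g) = aₙ(g)`. [cite: DiamondShurman2005, §5.7 p. 211] -/
theorem cuspCoeff_iota_one {M L : ℕ} [NeZero M] [NeZero L] (h : M * 1 ∣ L) (g : CuspForm (Gamma0 M) 2) (n : ℕ) :
    cuspCoeff (degeneracyMap0 M L 1 2 g) n = cuspCoeff g n := by
  rw [cuspCoeff_iota h, if_pos (one_dvd n), Nat.div_one, Nat.cast_one, one_mul]

/-- **`a_p(W) = 0` whenever `p² ∣ N`**, for any `X₀(N)`-datum of `W` (tree `cuspCoeff_eq_zero_of_sq_dvd_of_mem_newSubspace0`,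
PROVED, transported by `D.isNewformOf.2`). [cite: AtkinLehner1970, Thm. 3] -/
theorem lFunction_eq_zero_of_sq_dvd {W : WeierstrassCurve ℚ} [W.IsElliptic] (D : ModularParametrizationData W N)
    {p : ℕ} (hp : p.Prime) (hp2 : p ^ 2 ∣ N) : W.LFunction p = 0 := by
  have h := D.isNewformOf.2 p
  rw [cuspCoeff_eq_zero_of_sq_dvd_of_mem_newSubspace0 D.isNewformOf.1.1 hp hp2] at h
  exact_mod_cast h.symm

/-- **The conductor's primes are the level's primes** for any `X₀(N)`-datum (tree
`IsNewformOf.dvd_level_iff_dvd_conductorNorm`, PROVED). [cite: DiamondShurman2005, Prop. 5.8.5 and (8.44)] -/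
theorem dvd_conductorNorm_iff {W : WeierstrassCurve ℚ} [W.IsElliptic] (D : ModularParametrizationData W N)
    {p : ℕ} (hp : p.Prime) : p ∣ W.conductorNorm ℤ ↔ p ∣ N :=
  (D.isNewformOf.dvd_level_iff_dvd_conductorNorm hp).symm

end Generic

/-! ## §2 The curve side at level 56: `a₄ = 0`, `(a₃, a₅) ∈ {(0,2), (2,−4), (−2,0)}` — no Hasse bound used -/

section CurveSide

variable (W : WeierstrassCurve ℚ) [W.IsElliptic]

omit [W.IsElliptic] in
/-- `a₁₅ = a₃ a₅`. [cite: DiamondShurman2005, §8.8 (8.44)] -/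
theorem lFunction_fifteen : W.LFunction 15 = W.LFunction 3 * W.LFunction 5 := by
  have h := W.isMultiplicative_LFunction.map_mul_of_coprime (show Nat.Coprime 3 5 by norm_num)
  rwa [show (3 : ℕ) * 5 = 15 by norm_num] at h

/-- **The curve side of the level-56 exclusion (integers only, no Hasse bound).**  With `a₂ = 0`, `2 ∣ N_W`, `3 ∤ N_W`
(all three supplied fact-free from the datum by §1) and the two basis-free relations of `S₂(Γ₀(56))` at `n = 9, 15`:
`a₄ = 0` and `(a₃, a₅) ∈ {(0, 2), (2, −4), (−2, 0)}`. [cite: DiamondShurman2005, §8.8 (8.44)] -/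
theorem curveSide_fiftySix (ha2 : W.LFunction 2 = 0) (h2N : 2 ∣ W.conductorNorm ℤ) (h3N : ¬ 3 ∣ W.conductorNorm ℤ)
    (h9 : W.LFunction 9 = -1 - W.LFunction 3 - W.LFunction 5)
    (h15 : W.LFunction 15 = -2 - W.LFunction 3 + W.LFunction 5) :
    W.LFunction 4 = 0 ∧
      ((W.LFunction 3 = 0 ∧ W.LFunction 5 = 2) ∨ (W.LFunction 3 = 2 ∧ W.LFunction 5 = -4) ∨
        (W.LFunction 3 = -2 ∧ W.LFunction 5 = 0)) := by
  have hrec4 := LevelFortyFour.lFunction_four W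
  rw [ha2, if_pos h2N, sub_zero, mul_zero] at hrec4
  refine ⟨hrec4, ?_⟩
  have hrec9 := LevelFortyFour.lFunction_nine W
  rw [h9, if_neg h3N] at hrec9
  have hm15 := lFunction_fifteen W
  rw [h15] at hm15
  generalize W.LFunction 3 = t at hrec9 hm15 ⊢
  generalize W.LFunction 5 = r at hrec9 hm15 ⊢
  have hr : r = 2 - t - t * t := by linarith
  subst hr
  have hfac : t * (t - 2) * (t + 2) = 0 := by linear_combination hm15
  rcases mul_eq_zero.mp hfac with h02 | hm2
  · rcases mul_eq_zero.mp h02 with h0 | h2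
    · subst h0; exact Or.inl ⟨rfl, by norm_num⟩
    · have ht : t = 2 := by linarith
      subst ht; exact Or.inr (Or.inl ⟨rfl, by norm_num⟩)
  · have ht : t = -2 := by linarith
    subst ht; exact Or.inr (Or.inr ⟨rfl, by norm_num⟩)

/-- **Coordinates at 56.**  If `(o₁, o₂, o₄, x, y)` are the coordinates of a form with `aₙ = aₙ(W)` on
`(ι₁φ₁₄, ι₂φ₁₄, ι₄φ₁₄, P₅₆, Q₅₆)` (column equations at `n = 1,2,3,4,5,9,15` from the certified table) and `a₂(W) = 0`,
`2 ∣ N_W`, `3 ∤ N_W`, then the vector is `(0,0,0,1,−1)` (56a), `(0,0,0,1,1)` (56b) or `(1,½,0,0,0)` (OLD).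
[cite: DiamondShurman2005, §8.8 (8.44)] [cite: CremonaAlgorithms1997, Table 3 (N = 56)] -/
theorem coeffVector_fiftySix (ha2 : W.LFunction 2 = 0) (h2N : 2 ∣ W.conductorNorm ℤ) (h3N : ¬ 3 ∣ W.conductorNorm ℤ)
    (o₁ o₂ o₄ x y : ℂ)
    (k1 : o₁ + x = (W.LFunction 1 : ℂ))
    (k2 : -o₁ + 2 * o₂ = (W.LFunction 2 : ℂ))
    (k3 : -2 * o₁ + x + y = (W.LFunction 3 : ℂ))
    (k4 : o₁ - 2 * o₂ + 4 * o₄ = (W.LFunction 4 : ℂ))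
    (k5 : -x - 3 * y = (W.LFunction 5 : ℂ))
    (k9 : o₁ - x + 2 * y = (W.LFunction 9 : ℂ))
    (k15 : -4 * x - 4 * y = (W.LFunction 15 : ℂ)) :
    (o₁ = 0 ∧ o₂ = 0 ∧ o₄ = 0 ∧ x = 1 ∧ y = -1) ∨ (o₁ = 0 ∧ o₂ = 0 ∧ o₄ = 0 ∧ x = 1 ∧ y = 1) ∨
      (o₁ = 1 ∧ o₂ = 1 / 2 ∧ o₄ = 0 ∧ x = 0 ∧ y = 0) := by
  rw [WeierstrassCurve.LFunction_apply_one, Int.cast_one] at k1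
  -- the two basis-free relations, transported to the integers `aₙ(W)`
  have hz9 : W.LFunction 9 = -1 - W.LFunction 3 - W.LFunction 5 := by
    have : ((W.LFunction 9 : ℤ) : ℂ) = ((-1 - W.LFunction 3 - W.LFunction 5 : ℤ) : ℂ) := by
      push_cast; linear_combination -k9 - k1 - k3 - k5
    exact_mod_cast this
  have hz15 : W.LFunction 15 = -2 - W.LFunction 3 + W.LFunction 5 := by
    have : ((W.LFunction 15 : ℤ) : ℂ) = ((-2 - W.LFunction 3 + W.LFunction 5 : ℤ) : ℂ) := by
      push_cast; linear_combination -k15 - 2 * k1 - k3 + k5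
    exact_mod_cast this
  -- the inverse of the pivot matrix
  have eo₁ : o₁ = (1/4 : ℂ) * 1 - (3/8 : ℂ) * (W.LFunction 3 : ℂ) - (1/8 : ℂ) * (W.LFunction 5 : ℂ) := by
    linear_combination (1/4 : ℂ) * k1 + (-3/8 : ℂ) * k3 + (-1/8 : ℂ) * k5
  have eo₂ : o₂ = (1/8 : ℂ) * 1 + (1/2 : ℂ) * (W.LFunction 2 : ℂ) - (3/16 : ℂ) * (W.LFunction 3 : ℂ) -
      (1/16 : ℂ) * (W.LFunction 5 : ℂ) := by
    linear_combination (1/8 : ℂ) * k1 + (1/2 : ℂ) * k2 + (-3/16 : ℂ) * k3 + (-1/16 : ℂ) * k5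
  have eo₄ : o₄ = (1/4 : ℂ) * (W.LFunction 2 : ℂ) + (1/4 : ℂ) * (W.LFunction 4 : ℂ) := by
    linear_combination (1/4 : ℂ) * k2 + (1/4 : ℂ) * k4
  have ex : x = (3/4 : ℂ) * 1 + (3/8 : ℂ) * (W.LFunction 3 : ℂ) + (1/8 : ℂ) * (W.LFunction 5 : ℂ) := by
    linear_combination (3/4 : ℂ) * k1 + (3/8 : ℂ) * k3 + (1/8 : ℂ) * k5
  have ey : y = -(1/4 : ℂ) * 1 - (1/8 : ℂ) * (W.LFunction 3 : ℂ) - (3/8 : ℂ) * (W.LFunction 5 : ℂ) := by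
    linear_combination (-1/4 : ℂ) * k1 + (-1/8 : ℂ) * k3 + (-3/8 : ℂ) * k5
  obtain ⟨h4, hcases⟩ := curveSide_fiftySix W ha2 h2N h3N hz9 hz15
  rcases hcases with ⟨h3, h5⟩ | ⟨h3, h5⟩ | ⟨h3, h5⟩
  · simp only [ha2, h3, h4, h5] at eo₁ eo₂ eo₄ ex ey
    push_cast at eo₁ eo₂ eo₄ ex ey
    exact Or.inl ⟨by linear_combination eo₁, by linear_combination eo₂, by linear_combination eo₄,
      by linear_combination ex, by linear_combination ey⟩
  · simp only [ha2, h3, h4, h5] at eo₁ eo₂ eo₄ ex ey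
    push_cast at eo₁ eo₂ eo₄ ex ey
    exact Or.inr (Or.inl ⟨by linear_combination eo₁, by linear_combination eo₂, by linear_combination eo₄,
      by linear_combination ex, by linear_combination ey⟩)
  · simp only [ha2, h3, h4, h5] at eo₁ eo₂ eo₄ ex ey
    push_cast at eo₁ eo₂ eo₄ ex ey
    exact Or.inr (Or.inr ⟨by linear_combination eo₁, by linear_combination eo₂, by linear_combination eo₄,
      by linear_combination ex, by linear_combination ey⟩)

end CurveSide

/-! ## §3 Level 56: the genus, the forms `P₅₆`, `Q₅₆`, the old forms, the span, and the turnkey -/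

section LevelFiftySix

/-- `ι_d φ₁₄ ∈ S₂(Γ₀(56))^{old}` for `d = 1, 2, 4`. [cite: AtkinLehner1970, §2] -/
theorem iota_phi14_mem_old (d : ℕ) [NeZero d] (hd : d = 1 ∨ d = 2 ∨ d = 4) :
    degeneracyMap0 14 56 d 2 cuspFormEta14 ∈ oldSubspace0 56 2 := by
  have hidx : (14, d) ∈ {x : ℕ × ℕ | x.1 ∈ Nat.properDivisors 56 ∧ x.1 * x.2 ∣ 56} := by
    rcases hd with rfl | rfl | rfl <;> decide
  rw [oldSubspace0]
  exact Submodule.mem_iSup_of_mem ⟨(14, d), hidx⟩ (LinearMap.mem_range_self _ _)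

/-- **Five forms with the pivot columns `n = 1,…,5` of the level-56 table span `S₂(Γ₀(56))`.** [folklore] -/
theorem exists_coords_fiftySix (g₁ g₂ g₄ P Q : CuspForm (Gamma0 56) 2)
    (c₁ : cuspCoeff g₁ 1 = 1) (c₂ : cuspCoeff g₁ 2 = -1) (c₃ : cuspCoeff g₁ 3 = -2) (c₄ : cuspCoeff g₁ 4 = 1)
    (c₅ : cuspCoeff g₁ 5 = 0)
    (d₁ : cuspCoeff g₂ 1 = 0) (d₂ : cuspCoeff g₂ 2 = 2) (d₃ : cuspCoeff g₂ 3 = 0) (d₄ : cuspCoeff g₂ 4 = -2)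
    (d₅ : cuspCoeff g₂ 5 = 0)
    (e₁ : cuspCoeff g₄ 1 = 0) (e₂ : cuspCoeff g₄ 2 = 0) (e₃ : cuspCoeff g₄ 3 = 0) (e₄ : cuspCoeff g₄ 4 = 4)
    (e₅ : cuspCoeff g₄ 5 = 0)
    (p₁ : cuspCoeff P 1 = 1) (p₂ : cuspCoeff P 2 = 0) (p₃ : cuspCoeff P 3 = 1) (p₄ : cuspCoeff P 4 = 0)
    (p₅ : cuspCoeff P 5 = -1)
    (q₁ : cuspCoeff Q 1 = 0) (q₂ : cuspCoeff Q 2 = 0) (q₃ : cuspCoeff Q 3 = 1) (q₄ : cuspCoeff Q 4 = 0)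
    (q₅ : cuspCoeff Q 5 = -3)
    (f : CuspForm (Gamma0 56) 2) : ∃ o₁ o₂ o₄ x y : ℂ, f = o₁ • g₁ + o₂ • g₂ + o₄ • g₄ + x • P + y • Q := by
  haveI : FiniteDimensional ℂ (CuspForm (Gamma0 56) 2) := finiteDimensional_cuspForm_gamma0 56 2
  have hli : LinearIndependent ℂ ![g₁, g₂, g₄, P, Q] := by
    rw [Fintype.linearIndependent_iff]
    intro c hc i
    rw [Fin.sum_univ_five] at hc
    simp only [Matrix.cons_val_zero, Matrix.cons_val_one, Matrix.cons_val] at hc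
    have r1 := congrArg (cuspCoeff · 1) hc
    have r2 := congrArg (cuspCoeff · 2) hc
    have r3 := congrArg (cuspCoeff · 3) hc
    have r4 := congrArg (cuspCoeff · 4) hc
    have r5 := congrArg (cuspCoeff · 5) hc
    simp only [cuspCoeff_comb₅, cuspCoeff_zero_form, c₁, c₂, c₃, c₄, c₅, d₁, d₂, d₃, d₄, d₅, e₁, e₂, e₃, e₄, e₅,
      p₁, p₂, p₃, p₄, p₅, q₁, q₂, q₃, q₄, q₅] at r1 r2 r3 r4 r5
    have hc0 : c 0 = 0 := by linear_combination (-2 * r1 + 3 * r3 + r5) / (-8)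
    have hc3 : c 3 = 0 := by linear_combination r1 - hc0
    have hc4 : c 4 = 0 := by linear_combination (r5 + hc3) / (-3)
    have hc1 : c 1 = 0 := by linear_combination (r2 + hc0) / 2
    have hc2 : c 2 = 0 := by linear_combination (r4 - hc0 + 2 * hc1) / 4
    fin_cases i <;> assumption
  have hspan := hli.span_eq_top_of_card_eq_finrank' (by rw [finrank_cuspForm_two_fiftySix]; simp)
  have hf : f ∈ Submodule.span ℂ (Set.range ![g₁, g₂, g₄, P, Q]) := by rw [hspan]; exact Submodule.mem_top
  obtain ⟨c, hc⟩ := Submodule.mem_span_range_iff_exists_fun ℂ |>.mp hf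
  refine ⟨c 0, c 1, c 2, c 3, c 4, ?_⟩
  rw [← hc, Fin.sum_univ_five]
  simp only [Matrix.cons_val_zero, Matrix.cons_val_one, Matrix.cons_val]

/-- **LEVEL-56 PINNING, ABSTRACT FORM.**  Any three OLD forms `g₁, g₂, g₄` and any two forms `P, Q` of `S₂(Γ₀(56))`
carrying the certified coefficient table at `n = 1,2,3,4,5,9,15` pin the newform of every `X₀(56)`-datum:
`D.f = P − Q` or `D.f = P + Q`. [cite: CremonaAlgorithms1997, Table 3 (N = 56)] -/
theorem f_eq_of_table_fiftySix {W : WeierstrassCurve ℚ} [W.IsElliptic] (D : ModularParametrizationData W 56)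
    (g₁ g₂ g₄ P Q : CuspForm (Gamma0 56) 2)
    (hg₁ : g₁ ∈ oldSubspace0 56 2) (hg₂ : g₂ ∈ oldSubspace0 56 2)
    (c₁ : cuspCoeff g₁ 1 = 1) (c₂ : cuspCoeff g₁ 2 = -1) (c₃ : cuspCoeff g₁ 3 = -2) (c₄ : cuspCoeff g₁ 4 = 1)
    (c₅ : cuspCoeff g₁ 5 = 0) (c₉ : cuspCoeff g₁ 9 = 1) (c₁₅ : cuspCoeff g₁ 15 = 0)
    (d₁ : cuspCoeff g₂ 1 = 0) (d₂ : cuspCoeff g₂ 2 = 2) (d₃ : cuspCoeff g₂ 3 = 0) (d₄ : cuspCoeff g₂ 4 = -2)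
    (d₅ : cuspCoeff g₂ 5 = 0) (d₉ : cuspCoeff g₂ 9 = 0) (d₁₅ : cuspCoeff g₂ 15 = 0)
    (e₁ : cuspCoeff g₄ 1 = 0) (e₂ : cuspCoeff g₄ 2 = 0) (e₃ : cuspCoeff g₄ 3 = 0) (e₄ : cuspCoeff g₄ 4 = 4)
    (e₅ : cuspCoeff g₄ 5 = 0) (e₉ : cuspCoeff g₄ 9 = 0) (e₁₅ : cuspCoeff g₄ 15 = 0)
    (p₁ : cuspCoeff P 1 = 1) (p₂ : cuspCoeff P 2 = 0) (p₃ : cuspCoeff P 3 = 1) (p₄ : cuspCoeff P 4 = 0)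
    (p₅ : cuspCoeff P 5 = -1) (p₉ : cuspCoeff P 9 = -1) (p₁₅ : cuspCoeff P 15 = -4)
    (q₁ : cuspCoeff Q 1 = 0) (q₂ : cuspCoeff Q 2 = 0) (q₃ : cuspCoeff Q 3 = 1) (q₄ : cuspCoeff Q 4 = 0)
    (q₅ : cuspCoeff Q 5 = -3) (q₉ : cuspCoeff Q 9 = 2) (q₁₅ : cuspCoeff Q 15 = -4) :
    D.f = P - Q ∨ D.f = P + Q := by
  obtain ⟨o₁, o₂, o₄, x, y, hf⟩ := exists_coords_fiftySix g₁ g₂ g₄ P Q c₁ c₂ c₃ c₄ c₅ d₁ d₂ d₃ d₄ d₅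
    e₁ e₂ e₃ e₄ e₅ p₁ p₂ p₃ p₄ p₅ q₁ q₂ q₃ q₄ q₅ D.f
  have key : ∀ n, o₁ * cuspCoeff g₁ n + o₂ * cuspCoeff g₂ n + o₄ * cuspCoeff g₄ n + x * cuspCoeff P n +
      y * cuspCoeff Q n = (W.LFunction n : ℂ) := fun n ↦ by
    rw [← cuspCoeff_comb₅, ← hf]; exact D.isNewformOf.2 n
  have k1 := key 1; have k2 := key 2; have k3 := key 3; have k4 := key 4; have k5 := key 5
  have k9 := key 9; have k15 := key 15
  simp only [c₁, c₂, c₃, c₄, c₅, c₉, c₁₅, d₁, d₂, d₃, d₄, d₅, d₉, d₁₅, e₁, e₂, e₃, e₄, e₅, e₉, e₁₅,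
    p₁, p₂, p₃, p₄, p₅, p₉, p₁₅, q₁, q₂, q₃, q₄, q₅, q₉, q₁₅, mul_zero, mul_one, add_zero, zero_add] at k1 k2 k3 k4 k5 k9 k15
  -- the three curve-side inputs, fact-free from the datum
  have ha2 : W.LFunction 2 = 0 := lFunction_eq_zero_of_sq_dvd D Nat.prime_two ⟨14, by norm_num⟩
  have h2N : 2 ∣ W.conductorNorm ℤ := (dvd_conductorNorm_iff D Nat.prime_two).mpr ⟨28, by norm_num⟩
  have h3N : ¬ 3 ∣ W.conductorNorm ℤ := fun h ↦ absurd ((dvd_conductorNorm_iff D Nat.prime_three).mp h) (by norm_num)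
  rcases coeffVector_fiftySix W ha2 h2N h3N o₁ o₂ o₄ x y (by linear_combination k1) (by linear_combination k2)
      (by linear_combination k3) (by linear_combination k4) (by linear_combination k5) (by linear_combination k9)
      (by linear_combination k15)
    with ⟨ho₁, ho₂, ho₄, hx, hy⟩ | ⟨ho₁, ho₂, ho₄, hx, hy⟩ | ⟨ho₁, ho₂, ho₄, hx, hy⟩ <;>
    rw [ho₁, ho₂, ho₄, hx, hy] at hf <;> simp only [one_smul, zero_smul, add_zero, zero_add, neg_one_smul] at hf
  · left; rw [hf, sub_eq_add_neg]
  · right; exact hf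
  · exact absurd (hf ▸ Submodule.add_mem _ hg₁ (Submodule.smul_mem _ _ hg₂)) (not_mem_old_of_isNewform0 D.isNewformOf.1)

/-- **LEVEL-56 PINNING MODULO TWENTY-ONE q-COEFFICIENTS (planner-an g51's turnkey T-an-g51-56, verbatim up to the binders `P`, `Q`).**
For every `X₀(56)`-datum `D` of an elliptic `W/ℚ`: given the coefficients of `φ₁₄ = η₁η₂η₇η₁₄`, `P = η₄³η₁₄³/(η₂η₂₈)`, `Q = η₂³η₂₈³/(η₄η₁₄)` at
`n = 1,2,3,4,5,9,15`, `D.f = P − Q` (`= 56a1`) or `D.f = P + Q` (`= 56b1`) — no newness of either form is ever proved and no Hasse bound is used.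
[cite: CremonaAlgorithms1997, Table 3 (N = 56)] -/
theorem f_eq_of_coeffTable_fiftySix {W : WeierstrassCurve ℚ} [W.IsElliptic] (D : ModularParametrizationData W 56)
    (P Q : CuspForm (Gamma0 56) 2)
    (a₁ : cuspCoeff cuspFormEta14 1 = 1) (a₂ : cuspCoeff cuspFormEta14 2 = -1) (a₃ : cuspCoeff cuspFormEta14 3 = -2)
    (a₄ : cuspCoeff cuspFormEta14 4 = 1) (a₅ : cuspCoeff cuspFormEta14 5 = 0) (a₉ : cuspCoeff cuspFormEta14 9 = 1)
    (a₁₅ : cuspCoeff cuspFormEta14 15 = 0)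
    (p₁ : cuspCoeff P 1 = 1) (p₂ : cuspCoeff P 2 = 0) (p₃ : cuspCoeff P 3 = 1)
    (p₄ : cuspCoeff P 4 = 0) (p₅ : cuspCoeff P 5 = -1) (p₉ : cuspCoeff P 9 = -1)
    (p₁₅ : cuspCoeff P 15 = -4)
    (q₁ : cuspCoeff Q 1 = 0) (q₂ : cuspCoeff Q 2 = 0) (q₃ : cuspCoeff Q 3 = 1)
    (q₄ : cuspCoeff Q 4 = 0) (q₅ : cuspCoeff Q 5 = -3) (q₉ : cuspCoeff Q 9 = 2)
    (q₁₅ : cuspCoeff Q 15 = -4) :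
    D.f = P - Q ∨ D.f = P + Q := by
  have h141 : 14 * 1 ∣ 56 := by norm_num
  have h142 : 14 * 2 ∣ 56 := by norm_num
  have h144 : 14 * 4 ∣ 56 := by norm_num
  set g₁ := degeneracyMap0 14 56 1 2 cuspFormEta14 with hg₁
  set g₂ := degeneracyMap0 14 56 2 2 cuspFormEta14 with hg₂
  set g₄ := degeneracyMap0 14 56 4 2 cuspFormEta14 with hg₄
  -- the table of `g₁ = ι₁φ₁₄`
  have c : ∀ n, cuspCoeff g₁ n = cuspCoeff cuspFormEta14 n := fun n ↦ cuspCoeff_iota_one h141 _ n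
  -- the table of `g₂ = ι₂φ₁₄`: `a_{2m} = 2 a_m(φ₁₄)`, zero off the even columns
  have d₂ : cuspCoeff g₂ 2 = 2 := by
    show cuspCoeff g₂ (2 * 1) = 2
    rw [cuspCoeff_iota_mul h142, a₁]; norm_num
  have d₄ : cuspCoeff g₂ 4 = -2 := by
    show cuspCoeff g₂ (2 * 2) = -2
    rw [cuspCoeff_iota_mul h142, a₂]; norm_num
  have d0 : ∀ {n : ℕ}, ¬ 2 ∣ n → cuspCoeff g₂ n = 0 := fun hn ↦ cuspCoeff_iota_of_not_dvd h142 _ hn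
  -- the table of `g₄ = ι₄φ₁₄`
  have e₄ : cuspCoeff g₄ 4 = 4 := by
    show cuspCoeff g₄ (4 * 1) = 4
    rw [cuspCoeff_iota_mul h144, a₁]; norm_num
  have e₂ : cuspCoeff g₄ 2 = 0 := cuspCoeff_iota_of_not_dvd h144 _ (by decide)
  have e0 : ∀ {n : ℕ}, ¬ 4 ∣ n → cuspCoeff g₄ n = 0 := fun hn ↦ cuspCoeff_iota_of_not_dvd h144 _ hn
  exact f_eq_of_table_fiftySix D g₁ g₂ g₄ P Q (iota_phi14_mem_old 1 (Or.inl rfl))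
    (iota_phi14_mem_old 2 (Or.inr (Or.inl rfl)))
    ((c 1).trans a₁) ((c 2).trans a₂) ((c 3).trans a₃) ((c 4).trans a₄) ((c 5).trans a₅) ((c 9).trans a₉)
    ((c 15).trans a₁₅)
    (d0 (by decide)) d₂ (d0 (by decide)) d₄ (d0 (by decide)) (d0 (by decide)) (d0 (by decide))
    (e0 (by decide)) e₂ (e0 (by decide)) e₄ (e0 (by decide)) (e0 (by decide)) (e0 (by decide))
    p₁ p₂ p₃ p₄ p₅ p₉ p₁₅ q₁ q₂ q₃ q₄ q₅ q₉ q₁₅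

/-- **LEVEL-56 PINNING, fact-free** (turnkey T-an-g51-56 with its twenty-one `q`-coefficients discharged by `NewformsFiftySix`): for every
`X₀(56)`-datum `D` of an elliptic `W/ℚ` and the two `η`-quotient cusp forms `P = η₄³η₁₄³/(η₂η₂₈)`, `Q = η₂³η₂₈³/(η₄η₁₄)` of level `56`,
`D.f = P − Q` (`56a1`'s newform) or `D.f = P + Q` (`56b1`'s newform). [cite: CremonaAlgorithms1997, Table 3 (N = 56)] -/
theorem f_eq_fiftySix {W : WeierstrassCurve ℚ} [W.IsElliptic] (D : ModularParametrizationData W 56)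
    (P Q : CuspForm (Gamma0 56) 2) (hP : ⇑P = etaQuotient 56 (expFn [(2, -1), (4, 3), (14, 3), (28, -1)]))
    (hQ : ⇑Q = etaQuotient 56 (expFn [(2, 3), (4, -1), (14, -1), (28, 3)])) :
    D.f = P - Q ∨ D.f = P + Q := by
  obtain ⟨a₁, a₂, a₃, a₄, a₅, a₉, a₁₅⟩ := cuspCoeff_phi14
  obtain ⟨p₁, p₂, p₃, p₄, p₅, p₉, p₁₅⟩ := cuspCoeff_P56 P hP
  obtain ⟨q₁, q₂, q₃, q₄, q₅, q₉, q₁₅⟩ := cuspCoeff_Q56 Q hQ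
  exact f_eq_of_coeffTable_fiftySix D P Q a₁ a₂ a₃ a₄ a₅ a₉ a₁₅ p₁ p₂ p₃ p₄ p₅ p₉ p₁₅ q₁ q₂ q₃ q₄ q₅ q₉ q₁₅

/-- **The same on underlying functions: `⇑D.f = P − Q` or `⇑D.f = P + Q` on `ℍ`**, with `P`, `Q` the explicit `η`-quotients — the form in
which the `η`-identity files of the `X₀(56) → 56a1 / 56b1` programme consume the pinning. [cite: CremonaAlgorithms1997, Table 3 (N = 56)] -/
theorem f_apply_eq_fiftySix {W : WeierstrassCurve ℚ} [W.IsElliptic] (D : ModularParametrizationData W 56) :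
    (⇑D.f = fun τ ↦ etaQuotient 56 (expFn [(2, -1), (4, 3), (14, 3), (28, -1)]) τ
        - etaQuotient 56 (expFn [(2, 3), (4, -1), (14, -1), (28, 3)]) τ)
    ∨ (⇑D.f = fun τ ↦ etaQuotient 56 (expFn [(2, -1), (4, 3), (14, 3), (28, -1)]) τ
        + etaQuotient 56 (expFn [(2, 3), (4, -1), (14, -1), (28, 3)]) τ) := by
  obtain ⟨P, hP⟩ := exists_cuspForm_P56; obtain ⟨Q, hQ⟩ := exists_cuspForm_Q56
  rcases f_eq_fiftySix D P Q hP hQ with h | h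
  · left; rw [h, CuspForm.coe_sub, hP, hQ]; rfl
  · right; rw [h, CuspForm.coe_add, hP, hQ]; rfl

end LevelFiftySix

end Summit.BirchSwinnertonDyer.BirchSwinnertonDyer.Theorems.ManinLocalTwoThree.NewformPinningFiftySix

end
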